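import Summits.AtomisticToContinuum.Crystallization.Theorems.HullExactificationCascadeExactHcpLocalTheoremFrame

/-!
# Route HullExactificationCascade — item `ExactHcpLocalTheorem` (G), helper 3: isometries fixing the frame

Helper file 3 for `stmt-AtomisticToContinuum-12093`.  Sites are injectively indexed; a vector
orthogonal to `u, v` of squared norm `h²` is `± h e₃`; the frame `(u, v, w + h e₃)` is a basis, so
two linear isometries agreeing on it are equal; **a linear isometry fixing `u` and `v` is the
identity or the horizontal mirror `σ_h`** (`eq_refl_or_mirrorH`); and the first step of hexagon
rigidity: if the image cluster `A '' N` contains the hexagon layer, `A⁻¹` maps hexagon sites to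
hexagon sites (`symm_hexagon`, by "no antipodal caps").  [folklore]
-/

noncomputable section

namespace Summit.AtomisticToContinuum.Crystallization.Theorems.ExactHcpLocal

open Literature.MathematicalPhysics.StatisticalMechanics

variable {a h : ℝ}

/-! ## Rigidity file: the frame basis, isometries fixing `u, v`, and hexagon rigidity -/

section Rigidity

open RealInnerProductSpace Literature.Geometry.DiscreteGeometry

/-- **Sites are injectively indexed** (`a ≠ 0`, `h ≠ 0`). [folklore] -/
theorem site_inj (ha : a ≠ 0) (hh : h ≠ 0) {k i j k' i' j' : ℤ}
    (he : barlowPos a h alternatingHagg k i j = barlowPos a h alternatingHagg k' i' j') :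
    k = k' ∧ i = i' ∧ j = j' := by
  have e2 := congrArg (fun x : EuclideanSpace ℝ (Fin 3) => x 2) he
  have e1 := congrArg (fun x : EuclideanSpace ℝ (Fin 3) => x 1) he
  have e0 := congrArg (fun x : EuclideanSpace ℝ (Fin 3) => x 0) he
  simp only [barlowPos_apply_two, barlowPos_apply_one, barlowPos_apply_zero] at e2 e1 e0
  have hk : (k : ℝ) = k' := by
    have : ((k : ℝ) - k') * h = 0 := by linarith
    simpa [sub_eq_zero, hh] using this
  have hk' : k = k' := by exact_mod_cast hk
  subst hk'
  have h3 : (0 : ℝ) < Real.sqrt 3 := by positivity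
  have hj : (j : ℝ) = j' := by
    have : a * Real.sqrt 3 / 2 * ((j : ℝ) - j') = 0 := by linarith
    rcases mul_eq_zero.1 this with h0 | h0
    · rcases mul_eq_zero.1 (show a * Real.sqrt 3 = 0 by linarith) with h1 | h1
      · exact absurd h1 ha
      · linarith
    · linarith
  have hj' : j = j' := by exact_mod_cast hj
  subst hj'
  have hi : (i : ℝ) = i' := by
    have : a * ((i : ℝ) - i') = 0 := by linarith
    simpa [sub_eq_zero, ha] using this
  exact ⟨rfl, by exact_mod_cast hi, rfl⟩

/-- **Vertical vectors**: a vector orthogonal to `u` and `v` of squared norm `h²` is `± h e₃`.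
[folklore] -/
theorem eq_layerNormal_or_neg (ha : a ≠ 0) {s : EuclideanSpace ℝ (Fin 3)}
    (hu : ⟪barlowPos a h alternatingHagg 0 1 0, s⟫ = 0)
    (hv : ⟪barlowPos a h alternatingHagg 0 0 1, s⟫ = 0) (hn : ‖s‖ ^ 2 = h ^ 2) :
    s = layerNormal h ∨ s = -layerNormal h := by
  rw [inner_fin3] at hu hv
  simp only [barlowPos_apply_zero, barlowPos_apply_one, barlowPos_apply_two, haggLabel_zero] at hu hv
  push_cast at hu hv
  have h3 : (0 : ℝ) < Real.sqrt 3 := by positivity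
  have hs0 : s 0 = 0 := by
    have : a * s 0 = 0 := by linarith
    simpa [ha] using this
  have hs1 : s 1 = 0 := by
    rw [hs0] at hv
    have : (a * Real.sqrt 3 / 2) * s 1 = 0 := by linarith
    rcases mul_eq_zero.1 this with h0 | h0
    · exfalso
      rcases mul_eq_zero.1 (show a * Real.sqrt 3 = 0 by linarith) with h1 | h1
      · exact ha h1
      · linarith
    · exact h0
  rw [norm_sq_fin3, hs0, hs1] at hn
  have hs2 : s 2 = h ∨ s 2 = -h := sq_eq_sq_iff_eq_or_eq_neg.1 (by linarith)
  rcases hs2 with h2 | h2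
  · left; ext l; fin_cases l <;> simp [layerNormal, hs0, hs1, h2]
  · right; ext l; fin_cases l <;> simp [layerNormal, hs0, hs1, h2]

/-- The frame `(u, v, w + h e₃) = (𝔰 0 1 0, 𝔰 0 0 1, 𝔰 1 0 0)` is linearly independent
(`a ≠ 0`, `h ≠ 0`). [folklore] -/
theorem linearIndependent_frame (ha : a ≠ 0) (hh : h ≠ 0) :
    LinearIndependent ℝ ![barlowPos a h alternatingHagg 0 1 0, barlowPos a h alternatingHagg 0 0 1,
      barlowPos a h alternatingHagg 1 0 0] := by
  rw [Fintype.linearIndependent_iff]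
  intro g hg
  have hL1 : haggLabel alternatingHagg 1 = 1 := haggLabel_alternating_of_odd odd_one
  have e2 := congrArg (fun x : EuclideanSpace ℝ (Fin 3) => x 2) hg
  have e1 := congrArg (fun x : EuclideanSpace ℝ (Fin 3) => x 1) hg
  have e0 := congrArg (fun x : EuclideanSpace ℝ (Fin 3) => x 0) hg
  simp only [Fin.sum_univ_three, Matrix.cons_val_zero, Matrix.cons_val_one, Matrix.cons_val_two,
    Matrix.tail_cons, Matrix.head_cons, PiLp.add_apply, PiLp.smul_apply, PiLp.zero_apply,
    barlowPos_apply_zero, barlowPos_apply_one, barlowPos_apply_two, haggLabel_zero, hL1,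
    smul_eq_mul] at e0 e1 e2
  push_cast at e0 e1 e2
  have h3 : (0 : ℝ) < Real.sqrt 3 := by positivity
  have has : a * Real.sqrt 3 ≠ 0 := by positivity
  have g2 : g 2 = 0 := by
    have : g 2 * h = 0 := by linarith
    simpa [hh] using this
  have g1 : g 1 = 0 := by
    rw [g2] at e1
    have : (g 1) * (a * Real.sqrt 3) = 0 := by linarith
    simpa [has] using this
  have g0 : g 0 = 0 := by
    rw [g1, g2] at e0
    have : g 0 * a = 0 := by linarith
    simpa [ha] using this
  intro i
  fin_cases i <;> assumption

/-- **Two linear isometries agreeing on the frame `u, v, w + h e₃` are equal.** [folklore] -/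
theorem eq_of_eq_on_frame (ha : a ≠ 0) (hh : h ≠ 0)
    {A B : EuclideanSpace ℝ (Fin 3) ≃ₗᵢ[ℝ] EuclideanSpace ℝ (Fin 3)}
    (hu : A (barlowPos a h alternatingHagg 0 1 0) = B (barlowPos a h alternatingHagg 0 1 0))
    (hv : A (barlowPos a h alternatingHagg 0 0 1) = B (barlowPos a h alternatingHagg 0 0 1))
    (hp : A (barlowPos a h alternatingHagg 1 0 0) = B (barlowPos a h alternatingHagg 1 0 0))
    (x : EuclideanSpace ℝ (Fin 3)) : A x = B x := by
  let b : Module.Basis (Fin 3) ℝ (EuclideanSpace ℝ (Fin 3)) :=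
    basisOfLinearIndependentOfCardEqFinrank (linearIndependent_frame ha hh) (by simp)
  have hb : ⇑b = ![barlowPos a h alternatingHagg 0 1 0, barlowPos a h alternatingHagg 0 0 1,
      barlowPos a h alternatingHagg 1 0 0] := coe_basisOfLinearIndependentOfCardEqFinrank _ _
  have key : A.toLinearEquiv.toLinearMap = B.toLinearEquiv.toLinearMap := by
    refine b.ext fun i => ?_
    fin_cases i
    · simpa [hb] using hu
    · simpa [hb] using hv
    · simpa [hb] using hp
  exact LinearMap.congr_fun key x

/-- `w + h e₃ = 𝔰 1 0 0` in the frame: `barlowPos 1 0 0 = barlowOffset + layerNormal`. [folklore] -/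
theorem site_one : barlowPos a h alternatingHagg 1 0 0 = barlowOffset a + layerNormal h := by
  have hL1 : haggLabel alternatingHagg 1 = 1 := haggLabel_alternating_of_odd odd_one
  simp [barlowPos, hL1]

/-- `3 w = u + v` for the sites. [folklore] -/
theorem three_smul_offset_eq :
    (3 : ℝ) • barlowOffset a = barlowPos a h alternatingHagg 0 1 0 + barlowPos a h alternatingHagg 0 0 1 := by
  rw [three_smul_barlowOffset]; simp [barlowPos]

/-- **Isometries fixing `u` and `v` are the identity or the horizontal mirror** `σ_h`: the image
`t` of `w + h e₃` has the inner products of `w + h e₃` with `u, v`, so `t − w ⊥ u, v` and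
`‖t − w‖² = h²`, whence `t = w ± h e₃`; then compare on the frame basis. [folklore] -/
theorem eq_refl_or_mirrorH (ha : a ≠ 0) (hh : h ≠ 0)
    (A : EuclideanSpace ℝ (Fin 3) ≃ₗᵢ[ℝ] EuclideanSpace ℝ (Fin 3))
    (hAu : A (barlowPos a h alternatingHagg 0 1 0) = barlowPos a h alternatingHagg 0 1 0)
    (hAv : A (barlowPos a h alternatingHagg 0 0 1) = barlowPos a h alternatingHagg 0 0 1) :
    (∀ x, A x = x) ∨ (∀ x, A x = (ℝ ∙ layerNormal h)ᗮ.reflection x) := by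
  set u := barlowPos a h alternatingHagg 0 1 0 with hudef
  set v := barlowPos a h alternatingHagg 0 0 1 with hvdef
  set p := barlowPos a h alternatingHagg 1 0 0 with hpdef
  set w := barlowOffset a with hwdef
  set e := layerNormal h with hedef
  have hp : p = w + e := site_one
  have h3w : (3 : ℝ) • w = u + v := three_smul_offset_eq
  have hL1 : haggLabel alternatingHagg 1 = 1 := haggLabel_alternating_of_odd odd_one
  -- inner products of the frame
  have ipu : ⟪u, p⟫ = a ^ 2 / 2 := by rw [hudef, hpdef, inner_u_site, hL1]; push_cast; ring
  have ipv : ⟪v, p⟫ = a ^ 2 / 2 := by rw [hvdef, hpdef, inner_v_site, hL1]; push_cast; ring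
  have ipp : ⟪p, p⟫ = a ^ 2 / 3 + h ^ 2 := by
    rw [real_inner_self_eq_norm_sq, hpdef, hcp_norm_sq_eq, hL1]; push_cast; ring
  have iwe : ⟪w, e⟫ = 0 := by rw [inner_fin3]; simp [hwdef, hedef, barlowOffset, layerNormal]
  have iee : ⟪e, e⟫ = h ^ 2 := by rw [real_inner_self_eq_norm_sq, hedef, norm_sq_e]
  have iww : ⟪w, w⟫ = a ^ 2 / 3 := by
    have h9 : ⟪(3 : ℝ) • w, (3 : ℝ) • w⟫ = 3 * a ^ 2 := by
      rw [h3w, inner_add_left, inner_add_right, inner_add_right,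
        real_inner_self_eq_norm_sq, real_inner_self_eq_norm_sq, hudef, hvdef, norm_sq_u,
        inner_u_site, inner_v_site, hcp_norm_sq_eq, haggLabel_zero]
      push_cast; ring
    rw [inner_smul_left, inner_smul_right] at h9
    simp only [RCLike.conj_to_real] at h9
    linarith
  have iwp : ⟪w, p⟫ = a ^ 2 / 3 := by
    rw [hp, inner_add_right, iww, iwe]; ring
  have iup' : ⟪u, A p⟫ = a ^ 2 / 2 := by rw [← hAu, A.inner_map_map, ipu]
  have ivp' : ⟪v, A p⟫ = a ^ 2 / 2 := by rw [← hAv, A.inner_map_map, ipv]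
  have ipp' : ⟪A p, A p⟫ = a ^ 2 / 3 + h ^ 2 := by rw [A.inner_map_map, ipp]
  have iwp' : ⟪w, A p⟫ = a ^ 2 / 3 := by
    have : ⟪(3 : ℝ) • w, A p⟫ = a ^ 2 := by rw [h3w, inner_add_left, iup', ivp']; ring
    rw [inner_smul_left] at this
    simp only [RCLike.conj_to_real] at this
    linarith
  -- the vertical vector `A p - w`
  set s := A p - w with hsdef
  have hsu : ⟪u, s⟫ = 0 := by
    rw [hsdef, inner_sub_right, iup']
    have : ⟪u, w⟫ = a ^ 2 / 2 := by
      have e1 : ⟪u, p⟫ = ⟪u, w⟫ + ⟪u, e⟫ := by rw [hp, inner_add_right]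
      have e2 : ⟪u, e⟫ = 0 := by rw [real_inner_comm, hudef, hedef, inner_e_site]; simp
      linarith
    linarith
  have hsv : ⟪v, s⟫ = 0 := by
    rw [hsdef, inner_sub_right, ivp']
    have : ⟪v, w⟫ = a ^ 2 / 2 := by
      have e1 : ⟪v, p⟫ = ⟪v, w⟫ + ⟪v, e⟫ := by rw [hp, inner_add_right]
      have e2 : ⟪v, e⟫ = 0 := by rw [real_inner_comm, hvdef, hedef, inner_e_site]; simp
      linarith
    linarith
  have hsn : ‖s‖ ^ 2 = h ^ 2 := by
    rw [← real_inner_self_eq_norm_sq, hsdef, inner_sub_left, inner_sub_right, inner_sub_right,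
      ipp', real_inner_comm w (A p), iwp', iww]
    ring
  have hAp : A p = p ∨ A p = (ℝ ∙ layerNormal h)ᗮ.reflection p := by
    have hmir : (ℝ ∙ layerNormal h)ᗮ.reflection p = w - e := by
      rw [hpdef, mirrorH_site hh]
      have hLm : haggLabel alternatingHagg (-1) = 1 := haggLabel_alternating_of_odd (by decide)
      simp [barlowPos, hLm, hwdef, hedef]
      ext l; fin_cases l <;> simp [barlowOffset, layerNormal]
    rcases eq_layerNormal_or_neg ha hsu hsv hsn with h1 | h1
    · left
      calc A p = s + w := by rw [hsdef]; abel
        _ = p := by rw [h1, hp, hedef]; abel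
    · right
      calc A p = s + w := by rw [hsdef]; abel
        _ = _ := by rw [h1, hmir, hedef]; abel
  have hMu : (ℝ ∙ layerNormal h)ᗮ.reflection u = u := by
    rw [hudef, mirrorH_site hh]; rfl
  have hMv : (ℝ ∙ layerNormal h)ᗮ.reflection v = v := by
    rw [hvdef, mirrorH_site hh]; rfl
  rcases hAp with h1 | h1
  · left
    exact eq_of_eq_on_frame ha hh (B := LinearIsometryEquiv.refl ℝ _) hAu hAv h1
  · right
    exact eq_of_eq_on_frame ha hh (hAu.trans hMu.symm) (hAv.trans hMv.symm) h1

/-- Membership in the image of a set under a linear isometry equivalence. [folklore] -/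
theorem mem_image_equiv_iff {A : EuclideanSpace ℝ (Fin 3) ≃ₗᵢ[ℝ] EuclideanSpace ℝ (Fin 3)}
    {S : Set (EuclideanSpace ℝ (Fin 3))} {x : EuclideanSpace ℝ (Fin 3)} :
    x ∈ A '' S ↔ A.symm x ∈ S := by
  rw [A.image_eq_preimage_symm]; rfl

/-- `−𝔰 0 i j = 𝔰 0 (−i) (−j)` (the hexagon layer is centrally symmetric). [folklore] -/
theorem neg_site_zero (i j : ℤ) :
    -barlowPos a h alternatingHagg 0 i j = barlowPos a h alternatingHagg 0 (-i) (-j) := by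
  have := site_sub_of_even (a := a) (h := h) Even.zero i j 0 0 0
  rw [barlowPos_alternating_zero, zero_sub] at this
  simpa using this

/-- **Preimages of hexagon sites are hexagon sites.** If the image `A '' N` of the cluster
contains the hexagon (and the origin), then `A⁻¹` maps each hexagon-layer cluster site to a
hexagon-layer cluster site: the preimage is a cluster site whose negative is again a site, hence
lies in an even layer (`even_of_neg_site_mem`). [folklore] -/
theorem symm_hexagon (ha : 0 < a) (hh : 0 < h) (hh1 : 64 / 100 * a ^ 2 < h ^ 2)
    (hh2 : h ^ 2 < 69 / 100 * a ^ 2)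
    (A : EuclideanSpace ℝ (Fin 3) ≃ₗᵢ[ℝ] EuclideanSpace ℝ (Fin 3))
    (hX : ∀ i j : ℤ, (-1 ≤ i ∧ i ≤ 1 ∧ -1 ≤ j ∧ j ≤ 1 ∧ -1 ≤ i + j ∧ i + j ≤ 1) →
      barlowPos a h alternatingHagg 0 i j ∈
        A '' {p : EuclideanSpace ℝ (Fin 3) | p ∈ hcpStacking a h ∧ ‖p‖ < 13 / 10 * a})
    {i j : ℤ} (hij : -1 ≤ i ∧ i ≤ 1 ∧ -1 ≤ j ∧ j ≤ 1 ∧ -1 ≤ i + j ∧ i + j ≤ 1) :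
    ∃ i' j' : ℤ, (-1 ≤ i' ∧ i' ≤ 1 ∧ -1 ≤ j' ∧ j' ≤ 1 ∧ -1 ≤ i' + j' ∧ i' + j' ≤ 1) ∧
      A.symm (barlowPos a h alternatingHagg 0 i j) = barlowPos a h alternatingHagg 0 i' j' := by
  have h1 := mem_image_equiv_iff.1 (hX i j hij)
  obtain ⟨⟨k', i', j', hk'⟩, hnorm⟩ := h1
  have h2 := mem_image_equiv_iff.1 (hX (-i) (-j) (by omega))
  rw [← neg_site_zero, map_neg, hk'] at h2
  have hev := even_of_neg_site_mem ha.ne' hh.ne' h2.1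
  rw [hk'] at hnorm
  have hidx := (norm_site_lt_iff ha hh1 hh2 k' i' j').1 hnorm
  have hk0 : k' = 0 := by
    rcases hidx with ⟨h0, -⟩ | ⟨h0 | h0, -⟩
    · exact h0
    · exact absurd (h0 ▸ hev) Int.not_even_one
    · exact absurd (h0 ▸ hev) (by decide)
  subst hk0
  exact ⟨i', j', by omega, hk'⟩

end Rigidity

end Summit.AtomisticToContinuum.Crystallization.Theorems.ExactHcpLocal

end
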